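import Summits.CriticalPhenomena.PercolationContinuityZ3.Theorems.PercNearOneGluingNoHeavyLowerTailSunflowerLawJoinCertificate
import Summits.CriticalPhenomena.PercolationContinuityZ3.Theorems.PercNearOneGluingNoHeavyLowerTailSunflowerPrincipalCore
import HarnessLib

/-!
# `NoHeavyLowerTail` (crux stmt-CriticalPhenomena-4575), abstract sunflower cubic at LAW level: the SATURATION REDUCTION —
# (C1-law), H-COMB, Lemma A/B and the `G`-row for ALL three-petal sunflowers of up-sets follow from the same rows for the
# GENERALIZED PRODUCT CLASS `PC(W₁,W₂,W₃)` (`E_k = W_k ∪ (W_i ∩ W_j)`, `W_i` ARBITRARY up-sets of the same cube), every `p`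

Support file (seat `prim-ineq-gen-2` gen 31; `--supports stmt-CriticalPhenomena-4575`).  Nothing is asserted about the crux; no
`sorry`, no named facts, standard axioms.  Memo: run/shared/lean/prim/prim-ineq-gen-2/BK-STRATUM-GEN31.md §3.

SETTING.  `μ = prodBernoulli p` on `Set ι`, `ι` finite; a three-petal sunflower of up-sets `E₁ ∩ E₂ = E₁ ∩ E₃ = E₂ ∩ E₃ = A` with cell vector
`m = cells p E₁ E₂ E₃ A = (b, c₁, c₂, c₃, a)` (`LawPencil.cells`); the lane's law-level rows (all CONJECTURES in general): Lemma A `LAform m ≥ 0`,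
Lemma B `LBform m ≥ 0`, (C1-law) `C1form m = max(a,b)·AG − e₃ ≥ 0`, H-COMB `Hform m = (a+b)·AG − e₃ ≥ 0`, `G`-row `Gform m = AG − e₃ ≥ 0`
(`AG = ab − e₂(c) ≥ 0` is Gladkov's theorem).

THE MOVE (`D`-saturation of the petal pair `(1,2)`).  Let `U = ↑((E₁ ∖ A) ∪ (E₂ ∖ A))` (up-closure of the two petal cells) and
`M = A ∖ U` (the FREE CORE: core sets lying above no petal-1 and no petal-2 set).  Then `(E₁ ∖ M, E₂ ∖ M, E₃; A ∖ M)` is again a sunflower of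
up-sets (`isUpperSet_sdiff_free`, `sunflower_move`); its cells are `(b, c₁, c₂, c₃ + w, a − w)` with `w = μ(M) ≥ 0` (`cells_move`), and
EVERY ROW WEAKLY DECREASES: `AG' = AG − w(b + c₁ + c₂)`, `LA' ≤ LA`, `LB' ≤ LB`, `H' ≤ H`, `C1' ≤ C1`, `G' ≤ G` (`forms_move_le`, pure algebra
plus Gladkov for the new sunflower).  After the move the pair `(1,2)` is SATURATED: `A' ⊆ ↑(C₁' ∪ C₂')` (`saturated_move`), and saturation of
the other pairs is preserved (`saturated_preserved`).  Three moves make every pair saturated, and a fully `D`-saturated sunflower IS a generalized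
product structure: `E_k = W_k ∪ (W_i ∩ W_j)`, `A = ⋃ W_i ∩ W_j` with `W_i = ↑(E_i ∖ A)` (`eq_pc_of_saturated`).

RESULTS (this file = the one-move machinery; the three-move reduction `exists_pc_le`, `C1_of_pc`, `lawH_of_pc`, `G_of_pc` is in the companion
`…SunflowerLawSaturationReduction`):
* `forms_move_le`, `sunflower_move`, `cells_move`, `forms_move` — the move and the exact monotonicity of all rows;
* `Saturated`, `saturated_move`, `saturated_of_subset`, `eq_pc_of_saturated` — saturation bookkeeping and the identification of fully
  saturated sunflowers with generalized product structures `PC(W₁,W₂,W₃)` (`pcE`, `pcCore`);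
* `pc_sunflower`, `pc_cells` — `PC(W)` is a sunflower of up-sets for arbitrary up-sets `W_i`, with cells `b = μ(no W_i)`, `c_i = μ(only W_i)`,
  `a = μ(at least two)`; `gladkov_three_events` — COROLLARY of Gladkov's theorem: for any three increasing events,
  `μ(none)·μ(at least two) ≥ Σ_{i<j} μ(only i)·μ(only j)`.
(The dual `E`-saturation `E₃ ↦ coreShadow E₁ A ∩ coreShadow E₂ A` — petal 3 absorbs the bottom sets below no petal-1/2 set — decreases the rows in
the same way and leads to the generalized COPRODUCT form `E_k = G_i ∩ G_j`; not needed here.  The partition-level analogue of the move is gen 19's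
`…SunflowerSaturation`; at law level the monotonicity is exact, not only first-order.)
-/

noncomputable section

namespace Summit.CriticalPhenomena.PercolationContinuityZ3.Theorems.SunflowerPartition

namespace LawSaturation

open MeasureTheory LawPencil LawRegion
open Literature.Probability.LatticeModels Literature.Probability.Percolation

variable {ι : Type*}

/-! ## The law-level rows as forms on cell vectors -/

/-- H-COMB's form `H(m) = (a + b)·AG(m) − c₁c₂c₃`. [prim-ineq-prove-1 H-COMB; restated] -/
def Hform (m : Fin 5 → ℝ) : ℝ := (m 4 + m 0) * AGform m - m 1 * m 2 * m 3

/-- (C1-law)'s form `C1(m) = max(a, b)·AG(m) − c₁c₂c₃`. [prim-ineq-prove-1 (C1-law); restated] -/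
def C1form (m : Fin 5 → ℝ) : ℝ := max (m 4) (m 0) * AGform m - m 1 * m 2 * m 3

/-- The `G`-row's form `G(m) = AG(m) − c₁c₂c₃`. [lane `G`-row / AG⁺; restated] -/
def Gform (m : Fin 5 → ℝ) : ℝ := AGform m - m 1 * m 2 * m 3

/-- **Row monotonicity under the move** (pure algebra): passing from `(b, c₁, c₂, c₃, a)` to `(b, c₁, c₂, c₃ + w, a − w)` with `w ≥ 0`,
nonnegative cells and nonnegative Gladkov form of the NEW vector, every row weakly decreases. [this work] -/
theorem forms_move_le {m m' : Fin 5 → ℝ} {w : ℝ} (hw : 0 ≤ w) (h0 : m' 0 = m 0) (h1 : m' 1 = m 1) (h2 : m' 2 = m 2)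
    (h3 : m' 3 = m 3 + w) (h4 : m' 4 = m 4 - w) (hm : ∀ i, 0 ≤ m i) (hm' : ∀ i, 0 ≤ m' i) (hAG' : 0 ≤ AGform m') :
    AGform m' ≤ AGform m ∧ LAform m' ≤ LAform m ∧ LBform m' ≤ LBform m ∧ Hform m' ≤ Hform m ∧
      C1form m' ≤ C1form m ∧ Gform m' ≤ Gform m := by
  have a0 := hm 0; have a1 := hm 1; have a2 := hm 2; have a3 := hm 3; have a4 := hm 4
  have b4 := hm' 4
  have hAGeq : AGform m' = AGform m - w * (m 0 + m 1 + m 2) := by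
    simp only [AGform, h0, h1, h2, h3, h4]; ring
  have hAGle : AGform m' ≤ AGform m := by rw [hAGeq]; nlinarith
  have hAG : 0 ≤ AGform m := le_trans hAG' hAGle
  have he3 : m 1 * m 2 * m 3 ≤ m' 1 * m' 2 * m' 3 := by
    rw [h1, h2, h3]; nlinarith [mul_nonneg a1 a2]
  refine ⟨hAGle, ?_, ?_, ?_, ?_, ?_⟩
  · -- LA
    simp only [LAform]
    have : m' 4 * AGform m' ≤ m 4 * AGform m := by
      rw [h4]; nlinarith [mul_nonneg hw hAG']
    linarith
  · simp only [LBform]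
    have : m' 0 * AGform m' ≤ m 0 * AGform m := by
      rw [h0]; exact mul_le_mul_of_nonneg_left hAGle a0
    linarith
  · simp only [Hform]
    have : (m' 4 + m' 0) * AGform m' ≤ (m 4 + m 0) * AGform m := by
      rw [h4, h0]; nlinarith [mul_nonneg hw hAG']
    linarith
  · simp only [C1form]
    have hmax : max (m' 4) (m' 0) ≤ max (m 4) (m 0) := by
      rw [h4, h0]; exact max_le_max (by linarith) le_rfl
    have hmax0 : 0 ≤ max (m' 4) (m' 0) := le_trans b4 (le_max_left _ _)
    have : max (m' 4) (m' 0) * AGform m' ≤ max (m 4) (m 0) * AGform m :=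
      mul_le_mul hmax hAGle hAG' (le_trans hmax0 hmax)
    linarith
  · simp only [Gform]; linarith

/-- Cell masses are nonnegative. [folklore] -/
theorem cells_nonneg (q : ι → unitInterval) (E₁ E₂ E₃ A : Set (Set ι)) : ∀ i, 0 ≤ cells q E₁ E₂ E₃ A i := by
  intro i
  fin_cases i
  · exact (measureReal_nonneg : 0 ≤ (prodBernoulli q).real (E₁ ∪ E₂ ∪ E₃)ᶜ)
  · exact (measureReal_nonneg : 0 ≤ (prodBernoulli q).real (E₁ \ A))
  · exact (measureReal_nonneg : 0 ≤ (prodBernoulli q).real (E₂ \ A))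
  · exact (measureReal_nonneg : 0 ≤ (prodBernoulli q).real (E₃ \ A))
  · exact (measureReal_nonneg : 0 ≤ (prodBernoulli q).real A)

/-! ## Up-closures and the free core -/

/-- Up-closure of a family of sets. [folklore] -/
def upc (S : Set (Set ι)) : Set (Set ι) := {T | ∃ s ∈ S, s ⊆ T}

/-- The up-closure is an up-set. [folklore] -/
theorem isUpperSet_upc (S : Set (Set ι)) : IsUpperSet (upc S) :=
  fun _ _ hTT' ⟨s, hs, hsT⟩ => ⟨s, hs, hsT.trans hTT'⟩

/-- `S ⊆ upc S`. [folklore] -/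
theorem subset_upc (S : Set (Set ι)) : S ⊆ upc S := fun s hs => ⟨s, hs, subset_rfl⟩

/-- `upc` is monotone. [folklore] -/
theorem upc_mono {S S' : Set (Set ι)} (h : S ⊆ S') : upc S ⊆ upc S' :=
  fun _ ⟨s, hs, hsT⟩ => ⟨s, h hs, hsT⟩

/-- An up-set containing `S` contains `upc S`. [folklore] -/
theorem upc_subset {S U : Set (Set ι)} (hU : IsUpperSet U) (h : S ⊆ U) : upc S ⊆ U :=
  fun _ ⟨_, hs, hsT⟩ => hU hsT (h hs)

/-- The **free core** of the petal pair `(E₁, E₂)`: core sets above no member of the petal cells `E₁ ∖ A`, `E₂ ∖ A`. [this work] -/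
def freeCore (E₁ E₂ A : Set (Set ι)) : Set (Set ι) := A \ upc ((E₁ \ A) ∪ (E₂ \ A))

/-- The free core lies in the core. [this work] -/
theorem freeCore_subset (E₁ E₂ A : Set (Set ι)) : freeCore E₁ E₂ A ⊆ A := Set.sdiff_subset

/-- Removing the free core from a petal up-set leaves an up-set. [this work] -/
theorem isUpperSet_sdiff_free {E A U : Set (Set ι)} (hE : IsUpperSet E) (hU : IsUpperSet U) (hEU : E \ A ⊆ U) :
    IsUpperSet (E \ (A \ U)) := by
  intro S T hST ⟨hS, hSM⟩
  refine ⟨hE hST hS, fun ⟨_, hTU⟩ => ?_⟩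
  have hSU : S ∈ U := by
    by_cases hSA : S ∈ A
    · by_contra h; exact hSM ⟨hSA, h⟩
    · exact hEU ⟨hS, hSA⟩
  exact hTU (hU hST hSU)

/-! ## The move: set identities -/

section Move

variable {E₁ E₂ E₃ A M : Set (Set ι)}

/-- Core and petal intersections after removing a part `M ⊆ A` of the core from two petals. [this work] -/
theorem sdiff_inter_sdiff_eq (h12 : E₁ ∩ E₂ = A) : (E₁ \ M) ∩ (E₂ \ M) = A \ M := by
  ext x; simp only [Set.mem_inter_iff, Set.mem_sdiff, ← h12]; tauto

/-- `(E₁ ∖ M) ∩ E₃ = A ∖ M` when `E₁ ∩ E₃ = A` and `M ⊆ A`... (only `E₁ ∩ E₃ = A` is needed, `M` arbitrary). [this work] -/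
theorem sdiff_inter_eq (h13 : E₁ ∩ E₃ = A) : (E₁ \ M) ∩ E₃ = A \ M := by
  ext x; simp only [Set.mem_inter_iff, Set.mem_sdiff, ← h13]; tauto

/-- The petal cell is unchanged: `(E ∖ M) ∖ (A ∖ M) = E ∖ A` for `M ⊆ A`. [this work] -/
theorem sdiff_sdiff_sdiff_eq {E : Set (Set ι)} (hMA : M ⊆ A) : (E \ M) \ (A \ M) = E \ A := by
  ext x; simp only [Set.mem_sdiff]
  constructor
  · rintro ⟨⟨hE, hM⟩, h⟩; exact ⟨hE, fun hA => h ⟨hA, hM⟩⟩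
  · rintro ⟨hE, hA⟩; exact ⟨⟨hE, fun hM => hA (hMA hM)⟩, fun h => hA h.1⟩

/-- The union of the three up-sets is unchanged (`M ⊆ E₃`). [this work] -/
theorem union_move_eq (hM3 : M ⊆ E₃) : (E₁ \ M) ∪ (E₂ \ M) ∪ E₃ = E₁ ∪ E₂ ∪ E₃ := by
  ext x; simp only [Set.mem_union, Set.mem_sdiff]
  constructor
  · rintro ((⟨h, -⟩ | ⟨h, -⟩) | h)
    · exact Or.inl (Or.inl h)
    · exact Or.inl (Or.inr h)
    · exact Or.inr h
  · rintro ((h | h) | h)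
    · by_cases hx : x ∈ M
      · exact Or.inr (hM3 hx)
      · exact Or.inl (Or.inl ⟨h, hx⟩)
    · by_cases hx : x ∈ M
      · exact Or.inr (hM3 hx)
      · exact Or.inl (Or.inr ⟨h, hx⟩)
    · exact Or.inr h

/-- The third petal cell grows by exactly `M`: `E₃ ∖ (A ∖ M) = (E₃ ∖ A) ∪ M` for `M ⊆ A ⊆ E₃`. [this work] -/
theorem sdiff_sdiff_eq_union (hMA : M ⊆ A) (hA3 : A ⊆ E₃) : E₃ \ (A \ M) = (E₃ \ A) ∪ M := by
  ext x; simp only [Set.mem_sdiff, Set.mem_union]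
  constructor
  · rintro ⟨h3, h⟩
    by_cases hx : x ∈ M
    · exact Or.inr hx
    · exact Or.inl ⟨h3, fun hA => h ⟨hA, hx⟩⟩
  · rintro (⟨h3, hA⟩ | hx)
    · exact ⟨h3, fun h => hA h.1⟩
    · exact ⟨hA3 (hMA hx), fun h => h.2 hx⟩

end Move

/-! ## The move on a sunflower of up-sets: structure, cells, rows -/

/-- **The moved family is a sunflower of up-sets** with core `A ∖ M`, `M` the free core of the pair `(1,2)`. [this work] -/
theorem sunflower_move {E₁ E₂ E₃ A : Set (Set ι)} (h₁ : IsUpperSet E₁) (h₂ : IsUpperSet E₂)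
    (h12 : E₁ ∩ E₂ = A) (h13 : E₁ ∩ E₃ = A) (h23 : E₂ ∩ E₃ = A) :
    IsUpperSet (E₁ \ freeCore E₁ E₂ A) ∧ IsUpperSet (E₂ \ freeCore E₁ E₂ A) ∧
    (E₁ \ freeCore E₁ E₂ A) ∩ (E₂ \ freeCore E₁ E₂ A) = A \ freeCore E₁ E₂ A ∧
    (E₁ \ freeCore E₁ E₂ A) ∩ E₃ = A \ freeCore E₁ E₂ A ∧
    (E₂ \ freeCore E₁ E₂ A) ∩ E₃ = A \ freeCore E₁ E₂ A := by
  refine ⟨?_, ?_, sdiff_inter_sdiff_eq h12, sdiff_inter_eq h13, sdiff_inter_eq h23⟩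
  · exact isUpperSet_sdiff_free h₁ (isUpperSet_upc _) ((Set.subset_union_left).trans (subset_upc _))
  · exact isUpperSet_sdiff_free h₂ (isUpperSet_upc _) ((Set.subset_union_right).trans (subset_upc _))

section Sunflower

variable [Fintype ι]

/-- **Cells of the moved sunflower**: `(b, c₁, c₂, c₃ + w, a − w)` with `w = μ(M) ≥ 0`. [this work] -/
theorem cells_move (p : ι → unitInterval) {E₁ E₂ E₃ A M : Set (Set ι)} (h13 : E₁ ∩ E₃ = A) (hMA : M ⊆ A) :
    cells p (E₁ \ M) (E₂ \ M) E₃ (A \ M) 0 = cells p E₁ E₂ E₃ A 0 ∧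
    cells p (E₁ \ M) (E₂ \ M) E₃ (A \ M) 1 = cells p E₁ E₂ E₃ A 1 ∧
    cells p (E₁ \ M) (E₂ \ M) E₃ (A \ M) 2 = cells p E₁ E₂ E₃ A 2 ∧
    cells p (E₁ \ M) (E₂ \ M) E₃ (A \ M) 3 = cells p E₁ E₂ E₃ A 3 + (prodBernoulli p).real M ∧
    cells p (E₁ \ M) (E₂ \ M) E₃ (A \ M) 4 = cells p E₁ E₂ E₃ A 4 - (prodBernoulli p).real M := by
  classical
  have hA3 : A ⊆ E₃ := by rw [← h13]; exact Set.inter_subset_right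
  have hM3 : M ⊆ E₃ := hMA.trans hA3
  have mM : MeasurableSet M := MeasurableSet.of_discrete
  have m3A : MeasurableSet (E₃ \ A) := MeasurableSet.of_discrete
  have hdisj : Disjoint (E₃ \ A) M := Set.disjoint_left.2 fun x hx hxM => hx.2 (hMA hxM)
  have hc3 : (prodBernoulli p).real (E₃ \ (A \ M)) = (prodBernoulli p).real (E₃ \ A) + (prodBernoulli p).real M := by
    rw [sdiff_sdiff_eq_union hMA hA3, measureReal_union hdisj mM]
  have ha : (prodBernoulli p).real (A \ M) = (prodBernoulli p).real A - (prodBernoulli p).real M := by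
    have h' : (prodBernoulli p).real (A \ M) + (prodBernoulli p).real M = (prodBernoulli p).real A := by
      rw [← measureReal_union (Set.disjoint_left.2 fun x hx hxM => hx.2 hxM) mM, Set.sdiff_union_of_subset hMA]
    linarith
  simp only [cells_apply_zero, cells_apply_one, cells_apply_two, cells_apply_three, cells_apply_four]
  refine ⟨by rw [union_move_eq hM3], by rw [sdiff_sdiff_sdiff_eq hMA], by rw [sdiff_sdiff_sdiff_eq hMA], hc3, ha⟩

/-- **Every row weakly decreases under the move** (Lemma A, Lemma B, H-COMB, (C1-law), `G`-row, and `AG`). [this work] -/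
theorem forms_move (p : ι → unitInterval) {E₁ E₂ E₃ A : Set (Set ι)} (h₁ : IsUpperSet E₁) (h₂ : IsUpperSet E₂)
    (h₃ : IsUpperSet E₃) (h12 : E₁ ∩ E₂ = A) (h13 : E₁ ∩ E₃ = A) (h23 : E₂ ∩ E₃ = A) :
    let M := freeCore E₁ E₂ A
    AGform (cells p (E₁ \ M) (E₂ \ M) E₃ (A \ M)) ≤ AGform (cells p E₁ E₂ E₃ A) ∧
    LAform (cells p (E₁ \ M) (E₂ \ M) E₃ (A \ M)) ≤ LAform (cells p E₁ E₂ E₃ A) ∧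
    LBform (cells p (E₁ \ M) (E₂ \ M) E₃ (A \ M)) ≤ LBform (cells p E₁ E₂ E₃ A) ∧
    Hform (cells p (E₁ \ M) (E₂ \ M) E₃ (A \ M)) ≤ Hform (cells p E₁ E₂ E₃ A) ∧
    C1form (cells p (E₁ \ M) (E₂ \ M) E₃ (A \ M)) ≤ C1form (cells p E₁ E₂ E₃ A) ∧
    Gform (cells p (E₁ \ M) (E₂ \ M) E₃ (A \ M)) ≤ Gform (cells p E₁ E₂ E₃ A) := by
  intro M
  obtain ⟨h₁', h₂', h12', h13', h23'⟩ := sunflower_move h₁ h₂ h12 h13 h23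
  obtain ⟨c0, c1, c2, c3, c4⟩ := cells_move p h13 (freeCore_subset E₁ E₂ A)
  have hAG' := AGform_cells_nonneg p h₁' h₂' h₃ h12' h13' h23'
  have hnn : ∀ i, 0 ≤ cells p E₁ E₂ E₃ A i := cells_nonneg p E₁ E₂ E₃ A
  have hnn' : ∀ i, 0 ≤ cells p (E₁ \ M) (E₂ \ M) E₃ (A \ M) i := cells_nonneg p _ _ _ _
  exact forms_move_le measureReal_nonneg c0 c1 c2 c3 c4 hnn hnn' hAG'

end Sunflower

/-! ## Saturation -/

/-- The pair `(E₁, E₂)` of the sunflower with core `A` is **saturated**: every core set lies above a petal-1 or a petal-2 set. [this work] -/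
def Saturated (E₁ E₂ A : Set (Set ι)) : Prop := A ⊆ upc ((E₁ \ A) ∪ (E₂ \ A))

/-- After the move the pair `(1,2)` is saturated. [this work] -/
theorem saturated_move {E₁ E₂ A : Set (Set ι)} :
    Saturated (E₁ \ freeCore E₁ E₂ A) (E₂ \ freeCore E₁ E₂ A) (A \ freeCore E₁ E₂ A) := by
  intro S ⟨hSA, hSM⟩
  rw [sdiff_sdiff_sdiff_eq (freeCore_subset E₁ E₂ A), sdiff_sdiff_sdiff_eq (freeCore_subset E₁ E₂ A)]
  by_contra h
  exact hSM ⟨hSA, h⟩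

/-- Saturation of a pair is preserved when the core shrinks and the two petal cells grow. [this work] -/
theorem saturated_of_subset {E₁ E₂ A E₁' E₂' A' : Set (Set ι)} (h : Saturated E₁ E₂ A) (hA : A' ⊆ A)
    (h1 : E₁ \ A ⊆ E₁' \ A') (h2 : E₂ \ A ⊆ E₂' \ A') : Saturated E₁' E₂' A' :=
  fun _ hS => upc_mono (Set.union_subset_union h1 h2) (h (hA hS))

/-- The generalized product structure `PC(W₁, W₂, W₃)`: petal up-sets `E_k = W_k ∪ (W_i ∩ W_j)`. [this work] -/
def pcE (W Wi Wj : Set (Set ι)) : Set (Set ι) := W ∪ (Wi ∩ Wj)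

/-- The core of `PC(W₁, W₂, W₃)`: at least two of the `W_i` ("`⋃ W_i ∩ W_j`"). [this work] -/
def pcCore (W₁ W₂ W₃ : Set (Set ι)) : Set (Set ι) := (W₁ ∩ W₂) ∪ (W₁ ∩ W₃) ∪ (W₂ ∩ W₃)

/-- **A fully saturated sunflower is a generalized product structure** `PC(W)` with `W_i = ↑(E_i ∖ A)`. [this work] -/
theorem eq_pc_of_saturated {E₁ E₂ E₃ A : Set (Set ι)} (h₁ : IsUpperSet E₁) (h₂ : IsUpperSet E₂) (h₃ : IsUpperSet E₃)
    (h12 : E₁ ∩ E₂ = A) (h13 : E₁ ∩ E₃ = A) (h23 : E₂ ∩ E₃ = A)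
    (s12 : Saturated E₁ E₂ A) (s13 : Saturated E₁ E₃ A) (s23 : Saturated E₂ E₃ A) :
    E₁ = pcE (upc (E₁ \ A)) (upc (E₂ \ A)) (upc (E₃ \ A)) ∧
    E₂ = pcE (upc (E₂ \ A)) (upc (E₁ \ A)) (upc (E₃ \ A)) ∧
    E₃ = pcE (upc (E₃ \ A)) (upc (E₁ \ A)) (upc (E₂ \ A)) ∧
    A = pcCore (upc (E₁ \ A)) (upc (E₂ \ A)) (upc (E₃ \ A)) := by
  -- `W_i ⊆ E_i` and `W_i ∩ W_j ⊆ A`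
  have hW1 : upc (E₁ \ A) ⊆ E₁ := upc_subset h₁ Set.sdiff_subset
  have hW2 : upc (E₂ \ A) ⊆ E₂ := upc_subset h₂ Set.sdiff_subset
  have hW3 : upc (E₃ \ A) ⊆ E₃ := upc_subset h₃ Set.sdiff_subset
  have hA1 : A ⊆ E₁ := by rw [← h12]; exact Set.inter_subset_left
  have hA2 : A ⊆ E₂ := by rw [← h12]; exact Set.inter_subset_right
  have hA3 : A ⊆ E₃ := by rw [← h13]; exact Set.inter_subset_right
  have i12 : upc (E₁ \ A) ∩ upc (E₂ \ A) ⊆ A := fun x hx => h12 ▸ ⟨hW1 hx.1, hW2 hx.2⟩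
  have i13 : upc (E₁ \ A) ∩ upc (E₃ \ A) ⊆ A := fun x hx => h13 ▸ ⟨hW1 hx.1, hW3 hx.2⟩
  have i23 : upc (E₂ \ A) ∩ upc (E₃ \ A) ⊆ A := fun x hx => h23 ▸ ⟨hW2 hx.1, hW3 hx.2⟩
  -- saturation in `upc`-split form: `A ⊆ upc Cᵢ ∪ upc Cⱼ`
  have split : ∀ {X Y : Set (Set ι)}, upc (X ∪ Y) ⊆ upc X ∪ upc Y := by
    intro X Y T ⟨s, hs, hsT⟩
    rcases hs with hs | hs
    · exact Or.inl ⟨s, hs, hsT⟩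
    · exact Or.inr ⟨s, hs, hsT⟩
  have t12 : A ⊆ upc (E₁ \ A) ∪ upc (E₂ \ A) := fun x hx => split (s12 hx)
  have t13 : A ⊆ upc (E₁ \ A) ∪ upc (E₃ \ A) := fun x hx => split (s13 hx)
  have t23 : A ⊆ upc (E₂ \ A) ∪ upc (E₃ \ A) := fun x hx => split (s23 hx)
  -- generic petal identity
  have petal : ∀ {E F G : Set (Set ι)}, A ⊆ E → upc (E \ A) ⊆ E → upc (F \ A) ∩ upc (G \ A) ⊆ A →
      A ⊆ upc (E \ A) ∪ upc (F \ A) → A ⊆ upc (E \ A) ∪ upc (G \ A) →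
      E = pcE (upc (E \ A)) (upc (F \ A)) (upc (G \ A)) := by
    intro E F G hAE hWE hFG hEF hEG
    ext x
    simp only [pcE, Set.mem_union, Set.mem_inter_iff]
    constructor
    · intro hx
      by_cases hxA : x ∈ A
      · rcases hEF hxA with h | hF
        · exact Or.inl h
        · rcases hEG hxA with h | hG
          · exact Or.inl h
          · exact Or.inr ⟨hF, hG⟩
      · exact Or.inl (subset_upc _ ⟨hx, hxA⟩)
    · rintro (h | ⟨hF, hG⟩)
      · exact hWE h
      · exact hAE (hFG ⟨hF, hG⟩)
  refine ⟨petal hA1 hW1 i23 t12 t13, petal hA2 hW2 i13 ?_ t23, petal hA3 hW3 i12 ?_ ?_, ?_⟩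
  · intro x hx; rcases t12 hx with h | h
    · exact Or.inr h
    · exact Or.inl h
  · intro x hx; rcases t13 hx with h | h
    · exact Or.inr h
    · exact Or.inl h
  · intro x hx; rcases t23 hx with h | h
    · exact Or.inr h
    · exact Or.inl h
  · ext x
    simp only [pcCore, Set.mem_union, Set.mem_inter_iff]
    constructor
    · intro hx
      rcases t12 hx with h1 | h2
      · rcases t23 hx with h2 | h3
        · exact Or.inl (Or.inl ⟨h1, h2⟩)
        · exact Or.inl (Or.inr ⟨h1, h3⟩)
      · rcases t13 hx with h1 | h3
        · exact Or.inl (Or.inl ⟨h1, h2⟩)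
        · exact Or.inr ⟨h2, h3⟩
    · rintro ((h | h) | h)
      · exact i12 h
      · exact i13 h
      · exact i23 h

/-! ## `PC(W₁, W₂, W₃)` for arbitrary up-sets is a sunflower of up-sets -/

/-- The petal up-sets of `PC(W)` are up-sets. [this work] -/
theorem isUpperSet_pcE {W Wi Wj : Set (Set ι)} (hW : IsUpperSet W) (hi : IsUpperSet Wi) (hj : IsUpperSet Wj) :
    IsUpperSet (pcE W Wi Wj) :=
  hW.union (hi.inter hj)

/-- **`PC(W)` is a sunflower**: the pairwise intersections of `E_k = W_k ∪ (W_i ∩ W_j)` all equal the core "at least two `W`". [this work] -/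
theorem pc_sunflower (W₁ W₂ W₃ : Set (Set ι)) :
    pcE W₁ W₂ W₃ ∩ pcE W₂ W₁ W₃ = pcCore W₁ W₂ W₃ ∧ pcE W₁ W₂ W₃ ∩ pcE W₃ W₁ W₂ = pcCore W₁ W₂ W₃ ∧
      pcE W₂ W₁ W₃ ∩ pcE W₃ W₁ W₂ = pcCore W₁ W₂ W₃ := by
  refine ⟨?_, ?_, ?_⟩ <;>
  · ext x; simp only [pcE, pcCore, Set.mem_inter_iff, Set.mem_union]; tauto

/-- **Cells of `PC(W)`**: bottom = "no `W_i`", petal `k` = "only `W_k`", core = "at least two". [this work] -/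
theorem pc_cells (W₁ W₂ W₃ : Set (Set ι)) :
    (pcE W₁ W₂ W₃ ∪ pcE W₂ W₁ W₃ ∪ pcE W₃ W₁ W₂)ᶜ = (W₁ ∪ W₂ ∪ W₃)ᶜ ∧
    pcE W₁ W₂ W₃ \ pcCore W₁ W₂ W₃ = W₁ \ (W₂ ∪ W₃) ∧
    pcE W₂ W₁ W₃ \ pcCore W₁ W₂ W₃ = W₂ \ (W₁ ∪ W₃) ∧
    pcE W₃ W₁ W₂ \ pcCore W₁ W₂ W₃ = W₃ \ (W₁ ∪ W₂) := by
  refine ⟨?_, ?_, ?_, ?_⟩ <;>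
  · ext x; simp only [pcE, pcCore, Set.mem_inter_iff, Set.mem_union, Set.mem_compl_iff, Set.mem_sdiff]; tauto

/-- **Gladkov for three arbitrary increasing events**: `μ(no Wᵢ)·μ(at least two Wᵢ) ≥ Σ_{i<j} μ(only Wᵢ)·μ(only Wⱼ)` under every product
measure — Gladkov's strong Harris–Kleitman inequality applied to the sunflower `PC(W)`. [cite: Gladkov2024StrongFKG, Thm. 2.1 (k = 3)] -/
theorem gladkov_three_events [Fintype ι] (p : ι → unitInterval) {W₁ W₂ W₃ : Set (Set ι)} (hW₁ : IsUpperSet W₁)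
    (hW₂ : IsUpperSet W₂) (hW₃ : IsUpperSet W₃) :
    (prodBernoulli p).real (W₁ \ (W₂ ∪ W₃)) * (prodBernoulli p).real (W₂ \ (W₁ ∪ W₃)) +
        (prodBernoulli p).real (W₁ \ (W₂ ∪ W₃)) * (prodBernoulli p).real (W₃ \ (W₁ ∪ W₂)) +
        (prodBernoulli p).real (W₂ \ (W₁ ∪ W₃)) * (prodBernoulli p).real (W₃ \ (W₁ ∪ W₂)) ≤
      (prodBernoulli p).real ((W₁ ∩ W₂) ∪ (W₁ ∩ W₃) ∪ (W₂ ∩ W₃)) * (prodBernoulli p).real (W₁ ∪ W₂ ∪ W₃)ᶜ := by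
  obtain ⟨h12, h13, h23⟩ := pc_sunflower W₁ W₂ W₃
  obtain ⟨cb, c1, c2, c3⟩ := pc_cells W₁ W₂ W₃
  have h := prodBernoulli_strongHarris_sunflower_three p (isUpperSet_pcE hW₁ hW₂ hW₃) (isUpperSet_pcE hW₂ hW₁ hW₃)
    (isUpperSet_pcE hW₃ hW₁ hW₂) h12 h13 h23
  rw [cb, c1, c2, c3] at h
  simpa only [pcCore] using h

end LawSaturation

end Summit.CriticalPhenomena.PercolationContinuityZ3.Theorems.SunflowerPartition

end
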